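import Summits.Ventures.Crystal3D.Bulk.RotSysSwap
import HarnessLib

/-!
# Class counts under merging two classes; cycles of `swap a b * π` counted
# (generic brick for (G1c) of `phase2/LEAN-FACES-DESIGN.md` §5.4)

HONEST FRAMING. Part of the venture `Summits/Ventures/Crystal3D` (cell `pub-crystal3d`, phase 2;
seat typer-bulk-2), PURELY COMBINATORIAL and generic (folklore). Counting companions of
`Bulk/RotSysSwap.lean` for the class count `numClasses` of `Bulk/RotSysCounts.lean`:

* `card_image_filter_add` (splitting an image along a predicate with disjoint image parts),
  `card_image_le_one_of_forall_eq`;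
* **`numClasses_merge`**: merging the classes of `a` and `b` (in different classes) of an
  equivalence relation on `S` lowers the number of classes by exactly one;
* **`numClasses_sameCycle_swap_mul_add_one`**: for `a, b ∈ S` in different cycles of `π`,
  `numClasses (SameCycle (swap a b * π)) S + 1 = numClasses (SameCycle π) S`.

Nothing here mentions GAP(1.26).
-/

namespace Summit.Ventures.Crystal3D

namespace RotSys

open Equiv Equiv.Perm Finset

variable {D : Type*} [DecidableEq D]

section Counting

open scoped Classical

/-- Splitting an image along a predicate whose two parts have DISJOINT images:
`#(T.image f) = #((T.filter p).image f) + #((T.filter ¬p).image f)`. -/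
theorem card_image_filter_add {β : Type*} [DecidableEq β] (T : Finset D) (f : D → β)
    (p : D → Prop) [DecidablePred p] (hdisj : ∀ x ∈ T, ∀ y ∈ T, p x → ¬ p y → f x ≠ f y) :
    (T.image f).card = ((T.filter p).image f).card + ((T.filter fun x => ¬ p x).image f).card := by
  rw [← Finset.card_union_of_disjoint]
  · congr 1
    rw [← Finset.image_union, Finset.filter_union_filter_not_eq]
  · rw [Finset.disjoint_left]
    intro b hb hb'
    rw [Finset.mem_image] at hb hb'
    obtain ⟨x, hx, rfl⟩ := hb
    obtain ⟨y, hy, hxy⟩ := hb'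
    rw [Finset.mem_filter] at hx hy
    exact hdisj x hx.1 y hy.1 hx.2 hy.2 hxy.symm

omit [DecidableEq D] in
/-- An image all of whose values coincide has at most one element. -/
theorem card_image_le_one_of_forall_eq {β : Type*} [DecidableEq β] (T : Finset D) (f : D → β)
    (h : ∀ x ∈ T, ∀ y ∈ T, f x = f y) : (T.image f).card ≤ 1 := by
  rw [Finset.card_le_one]
  intro a ha b hb
  rw [Finset.mem_image] at ha hb
  obtain ⟨x, hx, rfl⟩ := ha
  obtain ⟨y, hy, rfl⟩ := hb
  exact h x hx y hy

end Counting

section Merge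

variable [Fintype D]

open scoped Classical

/-! ## Merging two classes lowers the class count by one -/

omit [Fintype D] in
/-- **Merging the classes of `a` and `b`.** Let `R` be an equivalence relation on `S`,
`a, b ∈ S` in different classes, and `R'` the relation "`R`, or both in the union of the classes
of `a` and `b`". Then `numClasses R' S + 1 = numClasses R S`. -/
theorem numClasses_merge {R R' : D → D → Prop} {S : Finset D}
    (hrefl : ∀ x ∈ S, R x x) (hsymm : ∀ x ∈ S, ∀ y ∈ S, R x y → R y x)
    (htrans : ∀ x ∈ S, ∀ y ∈ S, ∀ z ∈ S, R x y → R y z → R x z)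
    {a b : D} (ha : a ∈ S) (hb : b ∈ S) (hab : ¬ R a b)
    (hR' : ∀ z ∈ S, ∀ w ∈ S, R' z w ↔ R z w ∨ ((R a z ∨ R b z) ∧ (R a w ∨ R b w))) :
    numClasses R' S + 1 = numClasses R S := by
  unfold numClasses
  set A : D → Prop := fun z => R a z ∨ R b z with hA
  set cl : D → Finset D := fun x => S.filter fun y => R x y with hcl
  set cl' : D → Finset D := fun x => S.filter fun y => R' x y with hcl'
  -- outside `A` the classes agree; classes inside/outside `A` differ (for both relations)
  have hcl_out : ∀ x ∈ S, ¬ A x → cl' x = cl x := by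
    intro x hx hxA
    simp only [hcl, hcl']
    ext y
    simp only [Finset.mem_filter]
    constructor
    · rintro ⟨hy, h⟩
      rcases (hR' x hx y hy).1 h with h1 | ⟨h1, -⟩
      · exact ⟨hy, h1⟩
      · exact absurd h1 hxA
    · rintro ⟨hy, h⟩
      exact ⟨hy, (hR' x hx y hy).2 (Or.inl h)⟩
  have hA_closed : ∀ x ∈ S, ∀ y ∈ S, A x → R x y → A y := by
    intro x hx y hy hxA hxy
    rcases hxA with h | h
    · exact Or.inl (htrans a ha x hx y hy h hxy)
    · exact Or.inr (htrans b hb x hx y hy h hxy)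
  have hdisj : ∀ x ∈ S, ∀ y ∈ S, A x → ¬ A y → cl x ≠ cl y := by
    intro x hx y hy hxA hyA hxy
    have : y ∈ cl x := by rw [hxy]; exact Finset.mem_filter.2 ⟨hy, hrefl y hy⟩
    exact hyA (hA_closed x hx y hy hxA (Finset.mem_filter.1 this).2)
  have hdisj' : ∀ x ∈ S, ∀ y ∈ S, A x → ¬ A y → cl' x ≠ cl' y := by
    intro x hx y hy hxA hyA hxy
    have : y ∈ cl' x := by
      rw [hxy]; exact Finset.mem_filter.2 ⟨hy, (hR' y hy y hy).2 (Or.inl (hrefl y hy))⟩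
    have h' := (hR' x hx y hy).1 (Finset.mem_filter.1 this).2
    rcases h' with h1 | ⟨-, h1⟩
    · exact hyA (hA_closed x hx y hy hxA h1)
    · exact hyA h1
  rw [card_image_filter_add S cl' A hdisj', card_image_filter_add S cl A hdisj]
  have e_out : (S.filter fun x => ¬ A x).image cl' = (S.filter fun x => ¬ A x).image cl := by
    refine Finset.image_congr fun x hx => ?_
    rw [Finset.mem_coe, Finset.mem_filter] at hx
    exact hcl_out x hx.1 hx.2
  -- inside `A`: `cl'` is constant, `cl` takes exactly the two values `cl a ≠ cl b`
  have haA : a ∈ S.filter A := Finset.mem_filter.2 ⟨ha, Or.inl (hrefl a ha)⟩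
  have hbA : b ∈ S.filter A := Finset.mem_filter.2 ⟨hb, Or.inr (hrefl b hb)⟩
  have e_in' : ((S.filter A).image cl').card = 1 := by
    rw [Finset.card_eq_one]
    refine ⟨cl' a, ?_⟩
    apply Finset.eq_singleton_iff_unique_mem.2 ⟨Finset.mem_image_of_mem _ haA, ?_⟩
    intro C hC
    rw [Finset.mem_image] at hC
    obtain ⟨x, hx, rfl⟩ := hC
    rw [Finset.mem_filter] at hx
    simp only [hcl']
    ext y
    simp only [Finset.mem_filter]
    constructor
    · rintro ⟨hy, h⟩
      refine ⟨hy, (hR' a ha y hy).2 (Or.inr ⟨Or.inl (hrefl a ha), ?_⟩)⟩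
      rcases (hR' x hx.1 y hy).1 h with h1 | ⟨-, h1⟩
      · exact hA_closed x hx.1 y hy hx.2 h1
      · exact h1
    · rintro ⟨hy, h⟩
      refine ⟨hy, (hR' x hx.1 y hy).2 (Or.inr ⟨hx.2, ?_⟩)⟩
      rcases (hR' a ha y hy).1 h with h1 | ⟨-, h1⟩
      · exact Or.inl h1
      · exact h1
  have e_in : ((S.filter A).image cl).card = 2 := by
    have hne : cl a ≠ cl b := by
      intro h
      have : b ∈ cl a := by rw [h]; exact Finset.mem_filter.2 ⟨hb, hrefl b hb⟩
      exact hab (Finset.mem_filter.1 this).2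
    have : (S.filter A).image cl = {cl a, cl b} := by
      apply Finset.Subset.antisymm
      · intro C hC
        rw [Finset.mem_image] at hC
        obtain ⟨x, hx, rfl⟩ := hC
        rw [Finset.mem_filter] at hx
        rw [Finset.mem_insert, Finset.mem_singleton]
        rcases hx.2 with h | h
        · exact Or.inl (filter_eq_filter_of_rel hsymm htrans ha hx.1 h).symm
        · exact Or.inr (filter_eq_filter_of_rel hsymm htrans hb hx.1 h).symm
      · intro C hC
        rw [Finset.mem_insert, Finset.mem_singleton] at hC
        rcases hC with rfl | rfl
        · exact Finset.mem_image_of_mem _ haA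
        · exact Finset.mem_image_of_mem _ hbA
    rw [this, Finset.card_pair hne]
  rw [e_out, e_in', e_in]
  omega

/-- **Multiplying by a transposition of two points in different cycles merges exactly two
classes**: for `a, b ∈ S` with `¬ π.SameCycle a b`,
`numClasses (SameCycle (swap a b * π)) S + 1 = numClasses (SameCycle π) S`. -/
theorem numClasses_sameCycle_swap_mul_add_one (π : Perm D) {S : Finset D} {a b : D} (ha : a ∈ S)
    (hb : b ∈ S) (hab : ¬ π.SameCycle a b) :
    numClasses (fun x y => (swap a b * π).SameCycle x y) S + 1 =
      numClasses (fun x y => π.SameCycle x y) S :=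
  numClasses_merge (fun x _ => SameCycle.refl π x) (fun _ _ _ _ h => h.symm)
    (fun _ _ _ _ _ _ h1 h2 => h1.trans h2) ha hb hab
    (fun z _ w _ => sameCycle_swap_mul_iff_merge π hab z w)

end Merge

end RotSys

end Summit.Ventures.Crystal3D
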